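import Summits.RiemannHypothesis.RiemannHypothesis.Theorems.PfPersistenceDilatingLandau
import HarnessLib

/-!
# LANDAU for `θ(x) = Σ_{p ≤ x} log p`: the one-sided prime-only dictionary

Cell `pub-rhpf` (mechanism/rigidity campaign; **no RH claims**), CAND SEAT 7 gen 8, CASE-DAG v6 §6
kernel target LANDAU, addendum to `PfPersistenceDilatingLandau` (`K` = indicator on PRIMES, no prime
powers): one-sided power-scale readers of `θ(x) − x`. Since `θ ≤ ψ ≤ θ + 2√x log x` (Mathlib
`Chebyshev.theta_le_psi`, `Chebyshev.abs_psi_sub_theta_le_sqrt_mul_log`), every one-sided reader of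
`θ` is a one-sided reader of `ψ` at any scale `x^σ` with `σ > 1/2`:

* `re_le_of_theta_lower` / `quasiRiemannHypothesis_of_theta_lower`: `−A x^σ ≤ θ(x) − x` eventually
  (`σ ≥ 0`) ⇒ quasi-RH(`σ`); `not_eventually_theta_lower_of_le_half`: for `σ ≤ 1/2` this lower
  reader is violated by `ζ` itself (Littlewood, via `ψ`);
* `re_le_of_theta_upper` / `quasiRiemannHypothesis_of_theta_upper`: `θ(x) − x ≤ A x^σ` eventually
  with `σ > 1/2` ⇒ quasi-RH(`σ`);
* `riemannHypothesis_iff_theta_upper_eps` / `riemannHypothesis_iff_theta_lower_eps`: RH ⟺ either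
  one-sided `x^{1/2+ε}`-bound for every `ε > 0`;
* `riemannHypothesis_of_theta_le_self`: **the empirical prime deficit `θ(x) ≤ x` (true for all
  `x ≤ 10^{19}`), if it held for all large `x`, would imply RH** — so it is an RH-strength reader, not
  an RH-free invariant (and by Littlewood's `θ(x) − x = Ω₊(√x log log log x)`, not in tree, it fails).

Sorry-free; RH-free except the ⟹ halves of the `iff`s (von Koch, tree).

References: [MontgomeryVaughan2007] Montgomery–Vaughan, *Multiplicative Number Theory I*, Thm. 13.1,
§15.1; [Ingham1932] A. E. Ingham, *The Distribution of Prime Numbers*, Ch. V.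
-/

noncomputable section

-- the sub-problem path RiemannHypothesis/RiemannHypothesis duplicates a namespace (D-0017)
set_option linter.dupNamespace false

open Filter Asymptotics Real
open scoped Topology Chebyshev

namespace Summit.RiemannHypothesis.RiemannHypothesis.Theorems.PfPersistenceDilatingLandauTheta

open Literature.NumberTheory.LFunctions
open Summit.RiemannHypothesis.RiemannHypothesis.Theorems.PfPersistenceDilatingLandau

/-! ## §1 Lower readers of `θ` are lower readers of `ψ` -/

/-- **Lower one-sided bound on `θ(x) − x` ⇒ zeros confined**: if `−A x^σ ≤ θ(x) − x` for all large
`x`, every zero of `ζ` with `Re ρ > 0` has `Re ρ ≤ σ` (since `θ ≤ ψ`). [cite: MontgomeryVaughan2007, Thm. 15.3] -/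
theorem re_le_of_theta_lower {A σ : ℝ} (hev : ∀ᶠ x in atTop, -(A * x ^ σ) ≤ θ x - x)
    {ρ : ℂ} (h0 : riemannZeta ρ = 0) (hre : 0 < ρ.re) : ρ.re ≤ σ := by
  refine re_le_of_psi_oneSided (η := -1) (A := A) (Or.inr rfl) ?_ h0 hre
  filter_upwards [hev] with x hx
  have := Chebyshev.theta_le_psi x
  linarith

/-- **Lower `x^σ` bound on `θ(x) − x` ⇒ quasi-RH(`σ`)** (`σ ≥ 0`). [cite: MontgomeryVaughan2007, Thm. 15.3] -/
theorem quasiRiemannHypothesis_of_theta_lower {A σ : ℝ} (hσ : 0 ≤ σ)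
    (hev : ∀ᶠ x in atTop, -(A * x ^ σ) ≤ θ x - x) : QuasiRiemannHypothesis σ :=
  fun _s hs hσs _h1 ↦ (not_lt.2 (re_le_of_theta_lower hev hs (hσ.trans_lt hσs))) hσs

/-- **For `σ ≤ 1/2` the lower `θ`-reader is violated by `ζ` itself** (Littlewood's `Ω₋` for `ψ` and
`θ ≤ ψ`). [cite: MontgomeryVaughan2007, Thm. 15.11] -/
theorem not_eventually_theta_lower_of_le_half (A : ℝ) {σ : ℝ} (hσ : σ ≤ 1 / 2) :
    ¬ ∀ᶠ x in atTop, -(A * x ^ σ) ≤ θ x - x := by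
  intro h
  refine not_eventually_neg_mul_rpow_le_psi_sub_of_le_half A hσ ?_
  filter_upwards [h] with x hx
  have := Chebyshev.theta_le_psi x
  linarith

/-! ## §2 Upper readers of `θ` above the `√x log x` gauge are upper readers of `ψ` -/

/-- `2 √x log x ≤ x^σ` for all large `x` when `σ > 1/2`. [folklore] -/
theorem two_sqrt_mul_log_le_rpow {σ : ℝ} (hσ : 1 / 2 < σ) :
    ∀ᶠ x in atTop, 2 * x.sqrt * Real.log x ≤ x ^ σ := by
  have hε : 0 < σ - 1 / 2 := by linarith
  have hlog : (fun x : ℝ ↦ Real.log x) =o[atTop] fun x ↦ x ^ (σ - 1 / 2) :=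
    isLittleO_log_rpow_atTop hε
  have h := hlog.def (by norm_num : (0 : ℝ) < 1 / 2)
  filter_upwards [h, eventually_gt_atTop 0] with x hx hx0
  rw [Real.norm_eq_abs, Real.norm_eq_abs, abs_of_pos (Real.rpow_pos_of_pos hx0 _)] at hx
  have hl : Real.log x ≤ 1 / 2 * x ^ (σ - 1 / 2) := (le_abs_self _).trans hx
  have hs : x.sqrt = x ^ (1 / 2 : ℝ) := Real.sqrt_eq_rpow x
  have hs0 : 0 ≤ x.sqrt := Real.sqrt_nonneg x
  calc 2 * x.sqrt * Real.log x ≤ 2 * x.sqrt * (1 / 2 * x ^ (σ - 1 / 2)) :=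
        mul_le_mul_of_nonneg_left hl (by positivity)
    _ = x ^ (1 / 2 : ℝ) * x ^ (σ - 1 / 2) := by rw [hs]; ring
    _ = x ^ σ := by rw [← Real.rpow_add hx0]; congr 1; ring

/-- **Upper one-sided bound on `θ(x) − x` at a scale above `√x log x` ⇒ zeros confined**: if
`θ(x) − x ≤ A x^σ` for all large `x` with `σ > 1/2`, every zero of `ζ` with `Re ρ > 0` has `Re ρ ≤ σ`.
[cite: MontgomeryVaughan2007, Thm. 15.3, Thm. 13.1] -/
theorem re_le_of_theta_upper {A σ : ℝ} (hσ : 1 / 2 < σ) (hev : ∀ᶠ x in atTop, θ x - x ≤ A * x ^ σ)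
    {ρ : ℂ} (h0 : riemannZeta ρ = 0) (hre : 0 < ρ.re) : ρ.re ≤ σ := by
  refine re_le_of_psi_oneSided (η := 1) (A := A + 1) (Or.inl rfl) ?_ h0 hre
  filter_upwards [hev, two_sqrt_mul_log_le_rpow hσ, eventually_ge_atTop 1] with x hx hg hx1
  have hd := (abs_le.1 (Chebyshev.abs_psi_sub_theta_le_sqrt_mul_log hx1)).2
  linarith

/-- **Upper `x^σ` bound on `θ(x) − x` with `σ > 1/2` ⇒ quasi-RH(`σ`).** [cite: MontgomeryVaughan2007, Thm. 15.3] -/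
theorem quasiRiemannHypothesis_of_theta_upper {A σ : ℝ} (hσ : 1 / 2 < σ)
    (hev : ∀ᶠ x in atTop, θ x - x ≤ A * x ^ σ) : QuasiRiemannHypothesis σ :=
  fun _s hs hσs _h1 ↦ (not_lt.2 (re_le_of_theta_upper hσ hev hs (by linarith))) hσs

/-! ## §3 The one-sided `ε`-equivalences for `θ` -/

/-- Under RH, `|θ(x) − x| ≤ x^{1/2+ε}` eventually, for every `ε > 0`. [cite: MontgomeryVaughan2007, Thm. 13.1] -/
theorem abs_theta_sub_le_rpow_of_riemannHypothesis (hRH : RiemannHypothesis) {ε : ℝ} (hε : 0 < ε) :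
    ∀ᶠ x in atTop, |θ x - x| ≤ x ^ (1 / 2 + ε) := by
  have hε2 : 0 < ε / 2 := by linarith
  have hσ : (1 : ℝ) / 2 < 1 / 2 + ε / 2 := by linarith
  have hgrow : Tendsto (fun x : ℝ ↦ x ^ (ε / 2)) atTop atTop := tendsto_rpow_atTop hε2
  filter_upwards [abs_psi_sub_le_rpow_of_riemannHypothesis hRH hε2, two_sqrt_mul_log_le_rpow hσ,
    eventually_ge_atTop 1, hgrow.eventually_ge_atTop 2] with x hψ hg hx1 h2
  have hx0 : 0 < x := by linarith
  have hd := abs_le.1 (Chebyshev.abs_psi_sub_theta_le_sqrt_mul_log hx1)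
  have hψ' := abs_le.1 hψ
  have hpow : x ^ (1 / 2 + ε) = x ^ (1 / 2 + ε / 2) * x ^ (ε / 2) := by
    rw [← Real.rpow_add hx0]; congr 1; ring
  have hp0 : 0 ≤ x ^ (1 / 2 + ε / 2) := Real.rpow_nonneg hx0.le _
  have hbig : 2 * x ^ (1 / 2 + ε / 2) ≤ x ^ (1 / 2 + ε) := by
    rw [hpow, mul_comm]; exact mul_le_mul_of_nonneg_left h2 hp0
  rw [abs_le]
  constructor <;> linarith

/-- **RH ⟺ (∀ ε > 0, `θ(x) − x ≤ x^{1/2+ε}` for all large `x`).** [cite: MontgomeryVaughan2007, Thm. 13.1, Thm. 15.3] -/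
theorem riemannHypothesis_iff_theta_upper_eps :
    RiemannHypothesis ↔ ∀ ε : ℝ, 0 < ε → ∀ᶠ x in atTop, θ x - x ≤ x ^ (1 / 2 + ε) := by
  constructor
  · intro hRH ε hε
    filter_upwards [abs_theta_sub_le_rpow_of_riemannHypothesis hRH hε] with x hx
    exact (le_abs_self _).trans hx
  · intro h
    refine quasiRiemannHypothesis_one_half_iff_holds.mp fun s hs h1 _h2 ↦ ?_
    have hε : 0 < (s.re - 1 / 2) / 2 := by linarith
    have hev : ∀ᶠ x in atTop, θ x - x ≤ 1 * x ^ (1 / 2 + (s.re - 1 / 2) / 2) := by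
      simpa only [one_mul] using h _ hε
    have := re_le_of_theta_upper (by linarith) hev hs (by linarith)
    linarith

/-- **RH ⟺ (∀ ε > 0, `−x^{1/2+ε} ≤ θ(x) − x` for all large `x`).** [cite: MontgomeryVaughan2007, Thm. 13.1, Thm. 15.3] -/
theorem riemannHypothesis_iff_theta_lower_eps :
    RiemannHypothesis ↔ ∀ ε : ℝ, 0 < ε → ∀ᶠ x in atTop, -(x ^ (1 / 2 + ε)) ≤ θ x - x := by
  constructor
  · intro hRH ε hε
    filter_upwards [abs_theta_sub_le_rpow_of_riemannHypothesis hRH hε] with x hx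
    exact (abs_le.1 hx).1
  · intro h
    refine quasiRiemannHypothesis_one_half_iff_holds.mp fun s hs h1 _h2 ↦ ?_
    have hε : 0 < (s.re - 1 / 2) / 2 := by linarith
    have hev : ∀ᶠ x in atTop, -(1 * x ^ (1 / 2 + (s.re - 1 / 2) / 2)) ≤ θ x - x := by
      simpa only [one_mul] using h _ hε
    have := re_le_of_theta_lower hev hs (by linarith)
    linarith

/-- **`θ(x) ≤ x + A √x log x` for all large `x` ⇒ RH** (any fixed `A`; the `√x log x` gauge is
below every `x^σ`, `σ > 1/2`). [cite: MontgomeryVaughan2007, Thm. 13.1, Thm. 15.3] -/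
theorem riemannHypothesis_of_theta_le_sqrt_log {A : ℝ}
    (h : ∀ᶠ x in atTop, θ x - x ≤ A * (x.sqrt * Real.log x)) : RiemannHypothesis := by
  refine quasiRiemannHypothesis_one_half_iff_holds.mp fun s hs h1 _h2 ↦ ?_
  set σ : ℝ := (s.re + 1 / 2) / 2 with hσdef
  have hσ : 1 / 2 < σ := by rw [hσdef]; linarith
  have hev : ∀ᶠ x in atTop, 1 * (ψ x - x) ≤ (|A| + 2) / 2 * x ^ σ := by
    filter_upwards [h, two_sqrt_mul_log_le_rpow hσ, eventually_ge_atTop 1] with x hx hg hx1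
    have hl : 0 ≤ x.sqrt * Real.log x := mul_nonneg (Real.sqrt_nonneg x) (Real.log_nonneg hx1)
    have hA : A * (x.sqrt * Real.log x) ≤ |A| * (x.sqrt * Real.log x) :=
      mul_le_mul_of_nonneg_right (le_abs_self A) hl
    have hd := (abs_le.1 (Chebyshev.abs_psi_sub_theta_le_sqrt_mul_log hx1)).2
    have hm : (|A| + 2) / 2 * (2 * x.sqrt * Real.log x) ≤ (|A| + 2) / 2 * x ^ σ :=
      mul_le_mul_of_nonneg_left hg (by positivity)
    linarith
  have := re_le_of_psi_oneSided (η := 1) (Or.inl rfl) hev hs (by linarith)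
  rw [hσdef] at this
  linarith

/-- **The empirical prime deficit is an RH-strength reader:** if `θ(x) ≤ x` for all large `x`, then
RH. (Observed for all `x ≤ 10^{19}`; false eventually by Littlewood's `Ω₊` theorem, not in tree.)
[cite: MontgomeryVaughan2007, Thm. 15.3, §15.1; Ingham1932, Ch. V] -/
theorem riemannHypothesis_of_theta_le_self (h : ∀ᶠ x in atTop, θ x ≤ x) : RiemannHypothesis := by
  refine riemannHypothesis_of_theta_le_sqrt_log (A := 0) ?_
  filter_upwards [h] with x hx
  linarith

/-- **The one-sided trichotomy for `θ`, lower side** (mirror of `psi_oneSided_trichotomy`):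
`σ ≤ 1/2` violated by `ζ`; RH ⟺ the `x^{1/2+ε}`-∀ε reader; `σ ≥ 0` ⇒ quasi-RH(`σ`).
[cite: MontgomeryVaughan2007, Thm. 13.1, Thm. 15.3, Thm. 15.11] -/
theorem theta_lower_trichotomy :
    (∀ A σ : ℝ, σ ≤ 1 / 2 → ¬ ∀ᶠ x in atTop, -(A * x ^ σ) ≤ θ x - x) ∧
    (RiemannHypothesis ↔ ∀ ε : ℝ, 0 < ε → ∀ᶠ x in atTop, -(x ^ (1 / 2 + ε)) ≤ θ x - x) ∧
    (∀ A σ : ℝ, 0 ≤ σ → (∀ᶠ x in atTop, -(A * x ^ σ) ≤ θ x - x) → QuasiRiemannHypothesis σ) :=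
  ⟨fun A _ hσ ↦ not_eventually_theta_lower_of_le_half A hσ, riemannHypothesis_iff_theta_lower_eps,
    fun _ _ hσ hev ↦ quasiRiemannHypothesis_of_theta_lower hσ hev⟩

/-- **The one-sided dichotomy for `θ`, upper side**: RH ⟺ the `x^{1/2+ε}`-∀ε reader; `σ > 1/2` ⇒
quasi-RH(`σ`); and the `√x log x` gauge (in particular `θ ≤ x`) already implies RH.
[cite: MontgomeryVaughan2007, Thm. 13.1, Thm. 15.3] -/
theorem theta_upper_dichotomy :
    (RiemannHypothesis ↔ ∀ ε : ℝ, 0 < ε → ∀ᶠ x in atTop, θ x - x ≤ x ^ (1 / 2 + ε)) ∧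
    (∀ A σ : ℝ, 1 / 2 < σ → (∀ᶠ x in atTop, θ x - x ≤ A * x ^ σ) → QuasiRiemannHypothesis σ) ∧
    (∀ A : ℝ, (∀ᶠ x in atTop, θ x - x ≤ A * (x.sqrt * Real.log x)) → RiemannHypothesis) :=
  ⟨riemannHypothesis_iff_theta_upper_eps, fun _ _ hσ hev ↦ quasiRiemannHypothesis_of_theta_upper hσ hev,
    fun _ hev ↦ riemannHypothesis_of_theta_le_sqrt_log hev⟩

end Summit.RiemannHypothesis.RiemannHypothesis.Theorems.PfPersistenceDilatingLandauTheta

end
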